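import Summits.AnomalousDissipation.AnomalousDissipation.Theorems.SolenoidalFractalHomogenisationLagrangianStepSidebandResponseUniqueFrame
import Summits.AnomalousDissipation.AnomalousDissipation.Theorems.SolenoidalFractalHomogenisationLagrangianStepSidebandResponseExt
import HarnessLib

/-!
# K1L_D `LagrangianRenormalisationStepDesign` (stmt-AnomalousDissipation-27980), registered stub `stub_D1_V0thg` (v28, D28-3 (3)/D28-6/D28-7), port-map layer L4:
# THE PERIODIC EXTENSION `responseExtθ` OF THE TWISTED REFERENCE RESPONSE — globally defined, `P`-periodic, with a RIGHT derivative `Sθⱼ(t) + Gθ(t) ∘ Nⱼ(t)` at EVERY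
# time (one definition + facts; reviewed; `--kind definition --supports stmt-AnomalousDissipation-27980 --as helper`)

Summits-side file of route `SolenoidalFractalHomogenisation` (prover seat `ad-k1l-cellLawV-w1` g9; road of record D28-7 = port map §3 L4).  One definition (`responseExtθ`) and
its facts; no named facts, no sorry.  The frozen-frame twin of `…SidebandResponseExt`: `responseExtθ t = responseθ (toIcoMod P 0 t)`; `responseExtθ_of_mem_Ico`,
`responseExtθ_sub_zsmul`, `responseExtθ_add_period`, `sourceθ_toIcoMod`, `genθ_toIcoMod`, **`hasDerivWithinAt_responseExtθ`** (right derivative at every time),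
`continuousWithinAt_responseExtθ_Ici`, `norm_responseExtθ_le` (`≤ 8π‖αⱼ‖/min(γ₁, 4π²lo'c)` for a frame with `c|k|² ≤ |G₀ᵀk|²`).
NOT a proof of `stub_D1_V0thg`, of K1L_D, or of anomalous dissipation; rung F-D1.A0 infrastructure.
-/

set_option linter.dupNamespace false

noncomputable section

namespace Summit.AnomalousDissipation.AnomalousDissipation.Theorems.SolenoidalFractalHomogenisation.LagrangianStep.Sideband

open Set MeasureTheory Complex UnitAddTorus Filter Topology
open scoped InnerProductSpace
open Literature.Analysis Literature.Analysis.FunctionSpaces Literature.Analysis.FunctionSpaces.Torus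
open Literature.Analysis.FluidPDE Literature.Analysis.FluidPDE.Torus Literature.Analysis.FluidPDE.LatticeShear
open Summit.AnomalousDissipation.AnomalousDissipation.Theorems.SolenoidalFractalHomogenisation.PermissibleCarrier (period_pos)

variable {k₀ : ℕ}

/-! ## §1 The periodic extension -/

/-- **The `P`-periodic extension of the reference response of slot `j`**: `responseExt t = response (toIcoMod P 0 t)` (the representative of `t` in
`[0,P)`, `P = W₁.period`). [cite: SandersVerhulstMurdock2007, Lemma 5.2.7 (linear case)] -/
def responseExtθ (W₁ : LatticeWord k₀) (𝔸 : Torus.Visc4 (Fin 3)) (G₀ : Matrix (Fin 3) (Fin 3) ℝ) (γ₁ : ℝ) (R : ℕ) (j : Fin k₀) (t : ℝ) :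
    EuclideanSpace ℂ (Fin 3) →L[ℝ] Space R :=
  responseθ W₁ 𝔸 G₀ γ₁ R j (toIcoMod (period_pos W₁) 0 t)

/-- Unfolding `responseExt`. [cite: SandersVerhulstMurdock2007, Lemma 5.2.7 (linear case)] -/
theorem responseExtθ_def (W₁ : LatticeWord k₀) (𝔸 : Torus.Visc4 (Fin 3)) (G₀ : Matrix (Fin 3) (Fin 3) ℝ) (γ₁ : ℝ) (R : ℕ) (j : Fin k₀) (t : ℝ) :
    responseExtθ W₁ 𝔸 G₀ γ₁ R j t = responseθ W₁ 𝔸 G₀ γ₁ R j (toIcoMod (period_pos W₁) 0 t) := rfl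

/-- On the fundamental period the extension is the response. [cite: SandersVerhulstMurdock2007, Lemma 5.2.7 (linear case)] -/
theorem responseExtθ_of_mem_Ico (W₁ : LatticeWord k₀) (𝔸 : Torus.Visc4 (Fin 3)) (G₀ : Matrix (Fin 3) (Fin 3) ℝ) (γ₁ : ℝ) (R : ℕ) (j : Fin k₀) {t : ℝ}
    (ht : t ∈ Ico 0 W₁.period) : responseExtθ W₁ 𝔸 G₀ γ₁ R j t = responseθ W₁ 𝔸 G₀ γ₁ R j t := by
  rw [responseExtθ_def, (toIcoMod_eq_self (period_pos W₁)).2 (by simpa using ht)]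

/-- The extension is `P`-periodic (integer multiples). [cite: SandersVerhulstMurdock2007, Lemma 5.2.7 (linear case)] -/
theorem responseExtθ_sub_zsmul (W₁ : LatticeWord k₀) (𝔸 : Torus.Visc4 (Fin 3)) (G₀ : Matrix (Fin 3) (Fin 3) ℝ) (γ₁ : ℝ) (R : ℕ) (j : Fin k₀) (t : ℝ) (m : ℤ) :
    responseExtθ W₁ 𝔸 G₀ γ₁ R j (t - m • W₁.period) = responseExtθ W₁ 𝔸 G₀ γ₁ R j t := by
  rw [responseExtθ_def, responseExtθ_def, toIcoMod_sub_zsmul]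

/-- The extension is `P`-periodic. [cite: SandersVerhulstMurdock2007, Lemma 5.2.7 (linear case)] -/
theorem responseExtθ_add_period (W₁ : LatticeWord k₀) (𝔸 : Torus.Visc4 (Fin 3)) (G₀ : Matrix (Fin 3) (Fin 3) ℝ) (γ₁ : ℝ) (R : ℕ) (j : Fin k₀) (t : ℝ) :
    responseExtθ W₁ 𝔸 G₀ γ₁ R j (t + W₁.period) = responseExtθ W₁ 𝔸 G₀ γ₁ R j t := by
  have h := responseExtθ_sub_zsmul W₁ 𝔸 G₀ γ₁ R j (t + W₁.period) 1
  rw [one_zsmul, add_sub_cancel_right] at h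
  exact h.symm

/-- The source at the reduced time. [cite: MajdaKramer1999, §2.2.1.3] -/
theorem sourceθ_toIcoMod (W₁ : LatticeWord k₀) (G₀ : Matrix (Fin 3) (Fin 3) ℝ) (R : ℕ) (j : Fin k₀) (t : ℝ) :
    sourceθ W₁ G₀ R j (toIcoMod (period_pos W₁) 0 t) = sourceθ W₁ G₀ R j t := by
  have hper : Function.Periodic (fun τ => sourceθ W₁ G₀ R j τ) W₁.period := fun τ => sourceθ_add_period W₁ G₀ R j τ
  have h := hper.sub_zsmul_eq (toIcoDiv (period_pos W₁) 0 t) (x := t)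
  have e : t - toIcoDiv (period_pos W₁) 0 t • W₁.period = toIcoMod (period_pos W₁) 0 t := by
    have := toIcoMod_add_toIcoDiv_zsmul (period_pos W₁) 0 t; linarith
  rw [e] at h
  exact h

/-- The generator at the reduced time. [cite: MajdaKramer1999, §2.2.1.3] -/
theorem genθ_toIcoMod (W₁ : LatticeWord k₀) (𝔸 : Torus.Visc4 (Fin 3)) (G₀ : Matrix (Fin 3) (Fin 3) ℝ) (γ₁ : ℝ) (R : ℕ) (t : ℝ) :
    genθ W₁ 𝔸 G₀ γ₁ R (toIcoMod (period_pos W₁) 0 t) = genθ W₁ 𝔸 G₀ γ₁ R t := by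
  have hper : Function.Periodic (fun τ => genθ W₁ 𝔸 G₀ γ₁ R τ) W₁.period := fun τ => genθ_add_period W₁ 𝔸 G₀ γ₁ R τ
  have h := hper.sub_zsmul_eq (toIcoDiv (period_pos W₁) 0 t) (x := t)
  have e : t - toIcoDiv (period_pos W₁) 0 t • W₁.period = toIcoMod (period_pos W₁) 0 t := by
    have := toIcoMod_add_toIcoDiv_zsmul (period_pos W₁) 0 t; linarith
  rw [e] at h
  exact h

/-! ## §2 Right derivative at every time -/

/-- **The periodic extension of a periodic response has the RIGHT derivative `Sⱼ(t) + G(t) ∘ N(t)` at EVERY `t`.**  On the right-neighbourhood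
`[t, t + (P − t₀))` (`t₀ = toIcoMod P 0 t`) the extension is the shift `τ ↦ N(τ − (t − t₀))` of the response on `[t₀, P) ⊂ [0,P)`, where the response
is differentiable; the data are `P`-periodic. [cite: SandersVerhulstMurdock2007, Lemma 5.2.7 (linear case)] -/
theorem hasDerivWithinAt_responseExtθ (W₁ : LatticeWord k₀) (𝔸 : Torus.Visc4 (Fin 3)) (G₀ : Matrix (Fin 3) (Fin 3) ℝ) (γ₁ : ℝ) (R : ℕ) (j : Fin k₀)
    (hN : IsPeriodicResponseθ W₁ 𝔸 G₀ γ₁ R j (responseθ W₁ 𝔸 G₀ γ₁ R j)) (t : ℝ) :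
    HasDerivWithinAt (responseExtθ W₁ 𝔸 G₀ γ₁ R j)
      ((sourceθ W₁ G₀ R j t).restrictScalars ℝ + ((genθ W₁ 𝔸 G₀ γ₁ R t).restrictScalars ℝ).comp (responseExtθ W₁ 𝔸 G₀ γ₁ R j t)) (Ici t) t := by
  set P := W₁.period with hP
  have hP0 : 0 < P := period_pos W₁
  set t₀ := toIcoMod (period_pos W₁) 0 t with ht₀
  have ht₀I : t₀ ∈ Ico 0 P := by simpa [hP] using toIcoMod_mem_Ico' (period_pos W₁) t
  set d := t - t₀ with hd
  have hdz : d = toIcoDiv (period_pos W₁) 0 t • P := by rw [hd, ht₀, self_sub_toIcoMod]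
  -- the shifted response
  have hshift : HasDerivAt (fun τ => responseθ W₁ 𝔸 G₀ γ₁ R j (τ - d))
      ((sourceθ W₁ G₀ R j t₀).restrictScalars ℝ + ((genθ W₁ 𝔸 G₀ γ₁ R t₀).restrictScalars ℝ).comp (responseθ W₁ 𝔸 G₀ γ₁ R j t₀)) t := by
    have h1 := hN.2.1 t₀ ht₀I
    have h2 : t - d = t₀ := by rw [hd]; ring
    exact HasDerivAt.comp_sub_const t d (by rw [h2]; exact h1)
  -- agreement on a right-neighbourhood
  have hagree : ∀ τ ∈ Ico t (t + (P - t₀)), responseExtθ W₁ 𝔸 G₀ γ₁ R j τ = responseθ W₁ 𝔸 G₀ γ₁ R j (τ - d) := by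
    intro τ hτ
    rw [responseExtθ_def]
    congr 1
    rw [toIcoMod_eq_iff]
    refine ⟨⟨by linarith [hτ.1, ht₀I.1, hd], by linarith [hτ.2]⟩, toIcoDiv (period_pos W₁) 0 t, ?_⟩
    rw [← hdz]; ring
  have hmem : Ico t (t + (P - t₀)) ∈ 𝓝[≥] t := Ico_mem_nhdsGE (by linarith [ht₀I.2])
  have hev : ∀ᶠ τ in 𝓝[≥] t, responseExtθ W₁ 𝔸 G₀ γ₁ R j τ = responseθ W₁ 𝔸 G₀ γ₁ R j (τ - d) :=
    Filter.mem_of_superset hmem fun τ hτ => hagree τ hτ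
  have hval : responseExtθ W₁ 𝔸 G₀ γ₁ R j t = responseθ W₁ 𝔸 G₀ γ₁ R j (t - d) := hagree t ⟨le_rfl, by linarith [ht₀I.2]⟩
  have h := (hshift.hasDerivWithinAt (s := Ici t)).congr_of_eventuallyEq hev hval
  -- the data at `t₀` are the data at `t`
  have htd : t - d = t₀ := by rw [hd]; ring
  rw [ht₀, sourceθ_toIcoMod, genθ_toIcoMod, ← ht₀, ← htd, ← hval] at h
  exact h

/-- The extension is continuous from the right at every time. [cite: SandersVerhulstMurdock2007, Lemma 5.2.7 (linear case)] -/
theorem continuousWithinAt_responseExtθ_Ici (W₁ : LatticeWord k₀) (𝔸 : Torus.Visc4 (Fin 3)) (G₀ : Matrix (Fin 3) (Fin 3) ℝ) (γ₁ : ℝ) (R : ℕ) (j : Fin k₀)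
    (hN : IsPeriodicResponseθ W₁ 𝔸 G₀ γ₁ R j (responseθ W₁ 𝔸 G₀ γ₁ R j)) (t : ℝ) :
    ContinuousWithinAt (responseExtθ W₁ 𝔸 G₀ γ₁ R j) (Ici t) t :=
  (hasDerivWithinAt_responseExtθ W₁ 𝔸 G₀ γ₁ R j hN t).continuousWithinAt

/-! ## §3 The uniform bound -/

/-- **The periodic extension is uniformly bounded**: `‖responseExt t‖ ≤ 8π‖αⱼ‖/min(γ₁, 4π²lo')` at EVERY `t` (`NearIso 𝔸 lo' hi'`, `lo' > 0`, `γ₁ > 0`).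
[cite: SandersVerhulstMurdock2007, Lemma 5.2.7 (linear case)] -/
theorem norm_responseExtθ_le (W₁ : LatticeWord k₀) {𝔸 : Torus.Visc4 (Fin 3)} {lo' hi' : ℝ} (h𝔸 : Torus.NearIso 𝔸 lo' hi') (hlo' : 0 < lo')
    (G₀ : Matrix (Fin 3) (Fin 3) ℝ) {c : ℝ} (hc : 0 < c) (hG : ∀ k : Fin 3 → ℤ, c * freqNormSq k ≤ ∑ a, twistFreq G₀ k a ^ 2)
    {γ₁ : ℝ} (hγ₁ : 0 < γ₁) (R : ℕ) (j : Fin k₀) (t : ℝ) :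
    ‖responseExtθ W₁ 𝔸 G₀ γ₁ R j t‖ ≤ 8 * Real.pi * ‖slotAmp W₁ j‖ / min γ₁ (4 * Real.pi ^ 2 * (lo' * c)) := by
  rw [responseExtθ_def]
  exact norm_responseθ_le W₁ h𝔸 hlo' G₀ hc hG hγ₁ R j (Ico_subset_Icc_self (by simpa using toIcoMod_mem_Ico' (period_pos W₁) t))

end Summit.AnomalousDissipation.AnomalousDissipation.Theorems.SolenoidalFractalHomogenisation.LagrangianStep.Sideband

end
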